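import Literature.Computability.Complexity.PaulPippengerSzemerediTrotter1983Spec
import HarnessLib

/-!
# String formats of the four-alternation protocol (PPST 1983, §3)

Literature / complexity toolkit, seventeenth brick of the inline formalization of
Paul–Pippenger–Szemerédi–Trotter 1983 (`PaulPippengerSzemerediTrotter1983.lean`, fact
`PaulEtAl1983_NTIME_not_subset_DTIME`; roadmap Layer 4, assembly, part 2). The abstract data of
`…Spec.lean` (`Y1`, `Y3`, check descriptors `Q`, and the branch index) as binary strings, with
TOTAL decoders (every string decodes to `some` data or to `none`) and the round-trip property on
encoded data. The format is a stream of 2-bit tokens (`1d` = data bit `d`, `00` = end of field,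
`01` = end of record); a field is a run of data bits; numbers are unary (field length) or binary
(`bitsToNat`, least significant bit first); the decoders are the deterministic left-to-right
parsers the linear-time verifier will run.

* `Tok`, `toks` / `untoks` (`toks_untoks`); `field` / `encField` (`field_encField`);
* `Nums`, `Hv`, `groupsN` / `groupsH` (per-stack groups), `recP` / `encRec` (`recP_encRec`),
  `recsP`, **`decY1` / `encY1` (`decY1_encY1`)**;
* `decJ` / `encJ` (`decJ_encJ`: the branch index, raw unary);
* `Eg` / `encEg` / `egP` (entry groups: contents, claimed touchers, pointers), `entryP` /
  `encEntry`, **`decY3` / `encY3` (`decY3_encY3`)**;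
* **`decQ` / `encQ` (`decQ_encQ`)** — check descriptors.

No named fact is introduced (definitions with bodies and theorems only).

## References

* W. J. Paul, N. Pippenger, E. Szemerédi, W. T. Trotter, *On determinism versus non-determinism
  and related problems*, FOCS 1983, 429–438, §3 [PaulEtAl1983].
-/

namespace Literature.Computability.Complexity

open Function _root_.Computability

namespace PPSTSpec

/-! ### Tokens -/

/-- Tokens: a data bit, end of field, end of record. [folklore] -/
inductive Tok : Type
  | bit (d : Bool)
  | sep
  | stop
  deriving DecidableEq

/-- The 2-bit code of a token. [folklore] -/
def Tok.enc : Tok → List Bool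
  | .bit d => [true, d]
  | .sep => [false, false]
  | .stop => [false, true]

/-- The string of a token stream. [folklore] -/
def untoks (ts : List Tok) : List Bool := ts.flatMap Tok.enc

/-- **Tokenizing** (total): `none` on a dangling bit. [folklore] -/
def toks : List Bool → Option (List Tok)
  | [] => some []
  | [_] => none
  | true :: d :: w => (toks w).map (Tok.bit d :: ·)
  | false :: false :: w => (toks w).map (Tok.sep :: ·)
  | false :: true :: w => (toks w).map (Tok.stop :: ·)

/-- Round trip for tokens. [folklore] -/
theorem toks_untoks (ts : List Tok) : toks (untoks ts) = some ts := by
  induction ts with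
  | nil => rfl
  | cons t ts ih =>
    cases t with
    | bit d => simp [untoks, Tok.enc, toks] at ih ⊢; simpa [untoks] using ih
    | sep => simp [untoks, Tok.enc, toks] at ih ⊢; simpa [untoks] using ih
    | stop => simp [untoks, Tok.enc, toks] at ih ⊢; simpa [untoks] using ih

/-- Length of a token stream's string. [folklore] -/
theorem length_untoks (ts : List Tok) : (untoks ts).length = 2 * ts.length := by
  induction ts with
  | nil => rfl
  | cons t ts ih =>
    simp only [untoks, List.flatMap_cons, List.length_append, List.length_cons] at ih ⊢
    cases t <;> simp [Tok.enc] at ih ⊢ <;> omega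

/-! ### Fields -/

/-- The token stream of a field. [folklore] -/
def encField (w : List Bool) : List Tok := w.map Tok.bit ++ [Tok.sep]

/-- **Parsing a field** (total): data bits up to the end-of-field token; `none` on end of record
or end of stream. [folklore] -/
def field : List Tok → Option (List Bool × List Tok)
  | .bit d :: ts => (field ts).map fun p => (d :: p.1, p.2)
  | .sep :: ts => some ([], ts)
  | _ => none

/-- Round trip for fields. [folklore] -/
theorem field_encField (w : List Bool) (ts : List Tok) : field (encField w ++ ts) = some (w, ts) := by
  induction w with
  | nil => rfl
  | cons d w ih => simp [encField, field] at ih ⊢; simp [ih]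

/-- Length of a field's stream. [folklore] -/
@[simp] theorem length_encField (w : List Bool) : (encField w).length = w.length + 1 := by
  simp [encField]

/-! ### Per-stack groups -/

/-- The seven numbers of a stack in a record. [folklore] -/
structure Nums where
  /-- start height -/
  ht : ℕ
  /-- minimal boundary height -/
  mn : ℕ
  /-- maximal boundary height -/
  mx : ℕ
  /-- `lo` -/
  lo : ℕ
  /-- `hi` -/
  hi : ℕ
  /-- `cut` -/
  cut : ℕ
  /-- `hib` -/
  hib : ℕ
  deriving Inhabited

/-- The two heavy words of a stack. [folklore] -/
structure Hv where
  /-- start contents above the cut -/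
  frag : List Bool
  /-- end contents above the cut -/
  efrag : List Bool
  deriving Inhabited

/-- The stream of a number group (binary, least significant bit first). [folklore] -/
def encNums (g : Nums) : List Tok :=
  encField (encodeNat g.ht) ++ encField (encodeNat g.mn) ++ encField (encodeNat g.mx) ++
    encField (encodeNat g.lo) ++ encField (encodeNat g.hi) ++ encField (encodeNat g.cut) ++
    encField (encodeNat g.hib)

/-- Parsing a number group. [folklore] -/
def numsP (ts : List Tok) : Option (Nums × List Tok) := do
  let (w₁, ts) ← field ts
  let (w₂, ts) ← field ts
  let (w₃, ts) ← field ts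
  let (w₄, ts) ← field ts
  let (w₅, ts) ← field ts
  let (w₆, ts) ← field ts
  let (w₇, ts) ← field ts
  some (⟨bitsToNat w₁, bitsToNat w₂, bitsToNat w₃, bitsToNat w₄, bitsToNat w₅, bitsToNat w₆, bitsToNat w₇⟩, ts)

/-- Round trip for number groups. [folklore] -/
theorem numsP_encNums (g : Nums) (ts : List Tok) : numsP (encNums g ++ ts) = some (g, ts) := by
  obtain ⟨a₁, a₂, a₃, a₄, a₅, a₆, a₇⟩ := g
  simp only [encNums, List.append_assoc, numsP, field_encField, Option.bind_eq_bind, Option.bind_some,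
    bitsToNat_encodeNat]

/-- The stream of a heavy group (raw). [folklore] -/
def encHv (h : Hv) : List Tok := encField h.frag ++ encField h.efrag

/-- Parsing a heavy group. [folklore] -/
def hvP (ts : List Tok) : Option (Hv × List Tok) := do
  let (w₁, ts) ← field ts
  let (w₂, ts) ← field ts
  some (⟨w₁, w₂⟩, ts)

/-- Round trip for heavy groups. [folklore] -/
theorem hvP_encHv (h : Hv) (ts : List Tok) : hvP (encHv h ++ ts) = some (h, ts) := by
  obtain ⟨a₁, a₂⟩ := h
  simp only [encHv, List.append_assoc, hvP, field_encField, Option.bind_eq_bind, Option.bind_some]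

/-- Parsing `n` groups with a group parser. [folklore] -/
def groups {α : Type} (p : List Tok → Option (α × List Tok)) : ℕ → List Tok → Option (List α × List Tok)
  | 0, ts => some ([], ts)
  | n + 1, ts => do
      let (a, ts) ← p ts
      let (as, ts) ← groups p n ts
      some (a :: as, ts)

/-- Round trip for groups. [folklore] -/
theorem groups_enc {α : Type} {p : List Tok → Option (α × List Tok)} {e : α → List Tok}
    (hp : ∀ a ts, p (e a ++ ts) = some (a, ts)) :
    ∀ (as : List α) (ts : List Tok), groups p as.length (as.flatMap e ++ ts) = some (as, ts)
  | [], ts => rfl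
  | a :: as, ts => by
    simp only [List.length_cons, groups, List.flatMap_cons, List.append_assoc, hp, Option.bind_eq_bind,
      Option.bind_some, groups_enc hp as ts]

/-! ### Records -/

variable {K : ℕ}

/-- The number groups of a record. [folklore] -/
def numsOf (r : Rec K) : List Nums :=
  List.ofFn fun k : Fin K => ⟨r.ht k, r.mn k, r.mx k, r.lo k, r.hi k, r.cut k, r.hib k⟩

/-- The heavy groups of a record. [folklore] -/
def hvOf (r : Rec K) : List Hv := List.ofFn fun k : Fin K => ⟨r.frag k, r.efrag k⟩

/-- **The stream of a record**: counter (unary), number groups, `J` bit, heavy groups, end of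
record. [folklore] -/
def encRec (r : Rec K) : List Tok :=
  encField (List.replicate r.pc true) ++ (numsOf r).flatMap encNums ++ encField (if r.jbit then [true] else []) ++
    (hvOf r).flatMap encHv ++ [Tok.stop]

/-- Assembling a record from parsed parts. [folklore] -/
def mkRec (pcw : List Bool) (ns : List Nums) (jb : List Bool) (hs : List Hv) : Rec K :=
  { pc := pcw.length
    ht := fun k => (ns.getD k.val default).ht
    mn := fun k => (ns.getD k.val default).mn
    mx := fun k => (ns.getD k.val default).mx
    lo := fun k => (ns.getD k.val default).lo
    hi := fun k => (ns.getD k.val default).hi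
    cut := fun k => (ns.getD k.val default).cut
    hib := fun k => (ns.getD k.val default).hib
    jbit := !jb.isEmpty
    frag := fun k => (hs.getD k.val default).frag
    efrag := fun k => (hs.getD k.val default).efrag }

/-- **Parsing a record** (total). [folklore] -/
def recP (K : ℕ) (ts : List Tok) : Option (Rec K × List Tok) := do
  let (pcw, ts) ← field ts
  let (ns, ts) ← groups numsP K ts
  let (jb, ts) ← field ts
  let (hs, ts) ← groups hvP K ts
  match ts with
  | .stop :: ts => some (mkRec pcw ns jb hs, ts)
  | _ => none

/-- `getD` into `List.ofFn`. [folklore] -/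
theorem getD_ofFn {α : Type} {n : ℕ} (f : Fin n → α) (d : α) (k : Fin n) :
    (List.ofFn f).getD k.val d = f k := by
  rw [List.getD_eq_getElem?_getD, List.getElem?_ofFn]
  simp [k.isLt]

/-- Round trip for records. [folklore] -/
theorem recP_encRec (r : Rec K) (ts : List Tok) : recP K (encRec r ++ ts) = some (r, ts) := by
  have h1 := groups_enc (p := numsP) (e := encNums) numsP_encNums (numsOf r)
  have h2 := groups_enc (p := hvP) (e := encHv) hvP_encHv (hvOf r)
  have hl1 : (numsOf r).length = K := by simp [numsOf]
  have hl2 : (hvOf r).length = K := by simp [hvOf]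
  rw [hl1] at h1
  rw [hl2] at h2
  simp only [encRec, List.append_assoc, recP, field_encField, Option.bind_eq_bind, Option.bind_some, h1,
    h2, List.singleton_append]
  congr 1
  obtain ⟨pc, ht, mn, mx, lo, hi, cut, hib, jbit, frag, efrag⟩ := r
  simp only [mkRec, numsOf, hvOf, getD_ofFn, Prod.mk.injEq, and_true]
  congr 1
  · simp
  · cases jbit <;> simp

/-- Parsing records to the end of the stream (fuelled by the stream length). [folklore] -/
def recsP (K : ℕ) : ℕ → List Tok → Option (List (Rec K))
  | _, [] => some []
  | 0, _ :: _ => none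
  | n + 1, ts => do
      let (r, ts') ← recP K ts
      let rs ← recsP K n ts'
      some (r :: rs)

/-- A record's stream is nonempty, so parsing consumes. [folklore] -/
theorem length_encRec_pos (r : Rec K) : 0 < (encRec r).length := by
  simp [encRec]

/-- Round trip for record lists, with enough fuel. [folklore] -/
theorem recsP_enc (rs : List (Rec K)) : ∀ n, (rs.flatMap encRec).length ≤ n →
    recsP K n (rs.flatMap encRec) = some rs := by
  induction rs with
  | nil => intro n _; cases n <;> rfl
  | cons r rs ih =>
    intro n hn
    simp only [List.flatMap_cons, List.length_append] at hn ⊢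
    have hpos := length_encRec_pos r
    obtain ⟨n, rfl⟩ : ∃ m, n = m + 1 := ⟨n - 1, by omega⟩
    have hne : ∃ t tl, encRec r ++ List.flatMap encRec rs = t :: tl := by
      cases h : encRec r with
      | nil => rw [h] at hpos; simp at hpos
      | cons t tl => exact ⟨t, tl ++ List.flatMap encRec rs, by simp⟩
    obtain ⟨t, tl, htl⟩ := hne
    rw [htl]
    simp only [recsP]
    rw [← htl, recP_encRec, Option.bind_eq_bind, Option.bind_some, ih n (by omega)]
    rfl

/-- **The first existential string.** [folklore] -/
def encY1 (D : Y1 K) : List Bool := untoks (encField (List.replicate D.b true) ++ D.recs.flatMap encRec)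

/-- **Decoding the first existential string** (total; nonempty record list required). [folklore] -/
def decY1 (K : ℕ) (w : List Bool) : Option (Y1 K) := do
  let ts ← toks w
  let (bw, ts) ← field ts
  let rs ← recsP K ts.length ts
  if rs.isEmpty then none else some ⟨bw.length, rs⟩

/-- Round trip for the first existential string. [folklore] -/
theorem decY1_encY1 (D : Y1 K) (hD : D.recs ≠ []) : decY1 K (encY1 D) = some D := by
  obtain ⟨b, rs⟩ := D
  simp only [encY1, decY1, toks_untoks, Option.bind_eq_bind, Option.bind_some, field_encField,
    recsP_enc rs _ le_rfl, List.length_replicate]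
  cases rs with
  | nil => exact absurd rfl hD
  | cons r rs => simp

/-! ### The branch index (raw unary) -/

/-- The branch index string. [folklore] -/
def encJ (j : ℕ) : List Bool := List.replicate j true

/-- Decoding the branch index: all-`1` words only. [folklore] -/
def decJ (w : List Bool) : Option ℕ := if w.all id then some w.length else none

/-- Round trip for the branch index. [folklore] -/
theorem decJ_encJ (j : ℕ) : decJ (encJ j) = some j := by
  simp [decJ, encJ]

/-- Length of the branch index string. [folklore] -/
@[simp] theorem length_encJ (j : ℕ) : (encJ j).length = j := by simp [encJ]

/-! ### Branch entries -/

/-- One entry group (stack `k`): start and end contents, the claimed last touchers and the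
pointers for the two offsets. [folklore] -/
structure Eg where
  /-- start contents above the cut -/
  frag : List Bool
  /-- end contents above the cut -/
  efrag : List Bool
  /-- claimed last toucher, offset `0` -/
  lt0 : ℕ
  /-- claimed last toucher, offset `1` -/
  lt1 : ℕ
  /-- pointer, offset `0` -/
  ptr0 : ℕ
  /-- pointer, offset `1` -/
  ptr1 : ℕ
  deriving Inhabited

/-- The stream of an entry group: two raw fields, four numbers. [folklore] -/
def encEg (g : Eg) : List Tok :=
  encField g.frag ++ encField g.efrag ++ encField (encodeNat g.lt0) ++ encField (encodeNat g.lt1) ++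
    encField (encodeNat g.ptr0) ++ encField (encodeNat g.ptr1)

/-- Parsing an entry group. [folklore] -/
def egP (ts : List Tok) : Option (Eg × List Tok) := do
  let (w₁, ts) ← field ts
  let (w₂, ts) ← field ts
  let (w₃, ts) ← field ts
  let (w₄, ts) ← field ts
  let (w₅, ts) ← field ts
  let (w₆, ts) ← field ts
  some (⟨w₁, w₂, bitsToNat w₃, bitsToNat w₄, bitsToNat w₅, bitsToNat w₆⟩, ts)

/-- Round trip for entry groups. [folklore] -/
theorem egP_encEg (g : Eg) (ts : List Tok) : egP (encEg g ++ ts) = some (g, ts) := by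
  obtain ⟨a₁, a₂, a₃, a₄, a₅, a₆⟩ := g
  simp only [encEg, List.append_assoc, egP, field_encField, Option.bind_eq_bind, Option.bind_some,
    bitsToNat_encodeNat]

/-- The entry group of stack `k` of an entry. [folklore] -/
def Entry.eg (e : Entry K) (k : Fin K) : Eg :=
  ⟨e.frag k, e.efrag k, e.lt k false, e.lt k true, e.ptr k false, e.ptr k true⟩

/-- The stream of an entry: index (binary), entry groups, end of record. [folklore] -/
def encEntry (e : Entry K) : List Tok :=
  encField (encodeNat e.u) ++ (List.ofFn fun k : Fin K => e.eg k).flatMap encEg ++ [Tok.stop]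

/-- Parsing an entry. [folklore] -/
def entryP (K : ℕ) (ts : List Tok) : Option (Entry K × List Tok) := do
  let (uw, ts) ← field ts
  let (gs, ts) ← groups egP K ts
  match ts with
  | .stop :: ts => some (⟨bitsToNat uw, fun k => (gs.getD k.val default).frag,
      fun k => (gs.getD k.val default).efrag,
      fun k off => if off then (gs.getD k.val default).lt1 else (gs.getD k.val default).lt0,
      fun k off => if off then (gs.getD k.val default).ptr1 else (gs.getD k.val default).ptr0⟩, ts)
  | _ => none

/-- Round trip for entries. [folklore] -/
theorem entryP_encEntry (e : Entry K) (ts : List Tok) : entryP K (encEntry e ++ ts) = some (e, ts) := by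
  have h2 := groups_enc (p := egP) (e := encEg) egP_encEg (List.ofFn fun k : Fin K => e.eg k)
  rw [List.length_ofFn] at h2
  simp only [encEntry, List.append_assoc, entryP, field_encField, Option.bind_eq_bind, Option.bind_some, h2,
    List.singleton_append, bitsToNat_encodeNat]
  congr 1
  obtain ⟨u, frag, efrag, lt, ptr⟩ := e
  simp only [getD_ofFn, Entry.eg, Prod.mk.injEq, and_true]
  congr 1
  · funext k off; cases off <;> rfl
  · funext k off; cases off <;> rfl

/-- Parsing entries to the end of the stream. [folklore] -/
def entriesP (K : ℕ) : ℕ → List Tok → Option (List (Entry K))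
  | _, [] => some []
  | 0, _ :: _ => none
  | n + 1, ts => do
      let (e, ts') ← entryP K ts
      let es ← entriesP K n ts'
      some (e :: es)

/-- Round trip for entry lists. [folklore] -/
theorem entriesP_enc (es : List (Entry K)) : ∀ n, (es.flatMap encEntry).length ≤ n →
    entriesP K n (es.flatMap encEntry) = some es := by
  induction es with
  | nil => intro n _; cases n <;> rfl
  | cons e es ih =>
    intro n hn
    simp only [List.flatMap_cons, List.length_append] at hn ⊢
    have hpos : 0 < (encEntry e).length := by simp [encEntry]
    obtain ⟨n, rfl⟩ : ∃ m, n = m + 1 := ⟨n - 1, by omega⟩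
    have hne : ∃ t tl, encEntry e ++ List.flatMap encEntry es = t :: tl := by
      cases h : encEntry e with
      | nil => rw [h] at hpos; simp at hpos
      | cons t tl => exact ⟨t, tl ++ List.flatMap encEntry es, by simp⟩
    obtain ⟨t, tl, htl⟩ := hne
    rw [htl]
    simp only [entriesP]
    rw [← htl, entryP_encEntry, Option.bind_eq_bind, Option.bind_some, ih n (by omega)]
    rfl

/-- **The second existential string.** [folklore] -/
def encY3 (E : Y3 K) : List Bool := untoks (E.flatMap encEntry)

/-- **Decoding the second existential string** (total). [folklore] -/
def decY3 (K : ℕ) (w : List Bool) : Option (Y3 K) := do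
  let ts ← toks w
  entriesP K ts.length ts

/-- Round trip for the second existential string. [folklore] -/
theorem decY3_encY3 (E : Y3 K) : decY3 K (encY3 E) = some E := by
  simp only [encY3, decY3, toks_untoks, Option.bind_eq_bind, Option.bind_some, entriesP_enc E _ le_rfl]

/-! ### Check descriptors -/

/-- The code of a check descriptor: type, two indices, stack, offset. [folklore] -/
def Q.code : Q K → ℕ × ℕ × ℕ × ℕ × Bool
  | .arith m => (0, m, 0, 0, false)
  | .lightInit => (1, 0, 0, 0, false)
  | .final => (2, 0, 0, 0, false)
  | .jInA => (3, 0, 0, 0, false)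
  | .wf e => (4, e, 0, 0, false)
  | .distinct e e' => (5, e, e', 0, false)
  | .sim e => (6, e, 0, 0, false)
  | .init e => (7, e, 0, 0, false)
  | .closed e k off => (8, e, 0, k.val, off)
  | .dep e k off => (9, e, 0, k.val, off)
  | .notouch e k off m => (10, e, m, k.val, off)

/-- Decoding a code. [folklore] -/
def Q.ofCode (K : ℕ) (t a a₂ i : ℕ) (off : Bool) : Option (Q K) :=
  if hi : i < K then
    match t with
    | 0 => some (.arith a)
    | 1 => some .lightInit
    | 2 => some .final
    | 3 => some .jInA
    | 4 => some (.wf a)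
    | 5 => some (.distinct a a₂)
    | 6 => some (.sim a)
    | 7 => some (.init a)
    | 8 => some (.closed a ⟨i, hi⟩ off)
    | 9 => some (.dep a ⟨i, hi⟩ off)
    | 10 => some (.notouch a ⟨i, hi⟩ off a₂)
    | _ => none
  else none

/-- Round trip for codes. [folklore] -/
theorem Q.ofCode_code (q : Q K) (hK : 0 < K) :
    Q.ofCode K (q.code).1 (q.code).2.1 (q.code).2.2.1 (q.code).2.2.2.1 (q.code).2.2.2.2 = some q := by
  cases q <;> simp [Q.code, Q.ofCode, hK]

/-- **The stream of a check descriptor**: type (unary), two indices (binary), stack (unary),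
offset (a field of length `≤ 1`). [folklore] -/
def encQ (q : Q K) : List Bool :=
  untoks (encField (List.replicate (q.code).1 true) ++ encField (encodeNat (q.code).2.1) ++
    encField (encodeNat (q.code).2.2.1) ++ encField (List.replicate (q.code).2.2.2.1 true) ++
    encField (if (q.code).2.2.2.2 then [true] else []))

/-- **Decoding a check descriptor** (total). [folklore] -/
def decQ (K : ℕ) (w : List Bool) : Option (Q K) := do
  let ts ← toks w
  let (tw, ts) ← field ts
  let (aw, ts) ← field ts
  let (bw, ts) ← field ts
  let (iw, ts) ← field ts
  let (ow, _) ← field ts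
  Q.ofCode K tw.length (bitsToNat aw) (bitsToNat bw) iw.length (!ow.isEmpty)

/-- Round trip for check descriptors. [folklore] -/
theorem decQ_encQ (q : Q K) (hK : 0 < K) : decQ K (encQ q) = some q := by
  have h := Q.ofCode_code q hK
  simp only [encQ, decQ, List.append_assoc, toks_untoks, Option.bind_eq_bind, Option.bind_some]
  rw [← List.append_nil (encField (if (q.code).2.2.2.2 = true then [true] else []))]
  simp only [field_encField, Option.bind_some, List.length_replicate, bitsToNat_encodeNat]
  cases hc : (q.code).2.2.2.2 <;> simp_all

end PPSTSpec

end Literature.Computability.Complexity
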